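import Mathlib
import HarnessLib
import Summits.Ventures.LatticeQCDFlow.Scoring.MarkovChainCLTBatchMeans
import Summits.Ventures.LatticeQCDFlow.Scoring.MarkovChainCLTCoverage
import Summits.Ventures.LatticeQCDFlow.Scoring.CPNMetropolisSweepBatchMeans

/-!
# The `cpn_2d` heat-bath sweep followed by any exact update (the OR:HB production cycle): one-step
# minorisation, the CLT for time averages, consistent coin-free batch-means error bars — any start

HONEST FRAMING: exact (Metropolis-corrected) sampling algorithms for lattice gauge theory;
figures of merit are autocorrelation/cost numbers at stated couplings and volumes; no
continuum-physics claim.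

Venture `LatticeQCDFlow` (cell pub-lqcd), topic `Scoring`; FANOUT row 8 (`s0-cpn-nemc` — the 2D
CP(N−1) sampler seat, whose NE-MCMC evolutions relax with over-relaxation / heat-bath cycles —
GEN-19).  NEW WORK of the cell, not a published result; no definition is introduced.  Companion of
`Scoring/CPNMetropolisSweepBatchMeans.lean` for the engine's `'hb'` / `'hybrid'` modes: the scan of
single-variable heat baths `K = cycle (l.map (siteHeatBath cpnRef (gibbsDensity S)))` of row 9's
`Exactness/CPNHeatBathErgodic.lean`, followed by ANY Markov kernel `η` leaving `e^{−S} · ⊗(uniform)`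
invariant (over-relaxation reflections, further exact hits; `η = Kernel.id` is the plain sweep, by
`Kernel.id_comp`).  From the tree's `heatBathSweep_minorised`, `minorised_comp_left` and
`heatBathSweep_invariant_piGibbsLaw`: `η ∘ₖ K` is minorised IN ONE STEP by the probability law
`(⊗ uniform).bind η` with an explicit `ε ∈ (0, 1)` and leaves `cpnGibbsLaw` invariant; hence, by
row 8's chain-level theorems, for every bounded measurable observable and EVERY initial law: the CLT
for the time averages of the composite sweep with the Green–Kubo variance `σ²_f`, the consistency of
the batch-means estimate of `σ²_f`, and (for `σ²_f > 0`) the asymptotically exact coverage of the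
coin-free interval `f̄_N ± z σ̂_BM/√N`.  Value-free; idealised arithmetic; nothing is cited.

## Content (`l` visits every site and link; `S = cpnAction …`; `η` Markov with
## `Invariant η ((Measure.pi cpnRef).withDensity (gibbsDensity S))`)

* **`cpn_heatBathSweep_comp_minorised`** — `cpnGibbsLaw` is invariant for `η ∘ₖ K` and
  `∃ ε, 0 < ε < 1 ∧ ∀ ω A, ε · ((⊗ cpnRef).bind η) A ≤ (η ∘ₖ K) ω A`;
  `isMarkovKernel_cpnHeatBathSweep` — the `[IsMarkovKernel K]` instance the statements take;
* **`cpn_heatBathSweep_comp_timeAverage_clt`**, **`cpn_heatBathSweep_comp_batchMeans_tendstoInMeasure`**,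
  **`cpn_heatBathSweep_comp_batchMeans_coverage`**.
-/

noncomputable section

namespace Summit.Ventures.LatticeQCDFlow.Scoring

open MeasureTheory ProbabilityTheory Filter Finset Summit.Ventures.LatticeQCDFlow.Exactness
open Literature.Probability.MarkovChains
open scoped ENNReal Topology

section CPNHeatBath

variable {V E : Type*} [Fintype V] [Fintype E] [DecidableEq V] [DecidableEq E] {d : ℕ}
  (src tgt : E → V) (J : EuclideanSpace ℝ (Fin (d + 2)) →L[ℝ] EuclideanSpace ℝ (Fin (d + 2)))
  (c : E → ℝ)

/-- Every `cpn_2d` heat-bath scan is a Markov kernel (the instance the statements below take). -/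
theorem isMarkovKernel_cpnHeatBathSweep (l : List (V ⊕ E)) :
    IsMarkovKernel (cycle (l.map (siteHeatBath (cpnRef V E d) (gibbsDensity (cpnAction src tgt J c))))) := by
  have hS := continuous_cpnAction src tgt J c (V := V) (E := E) (d := d)
  haveI : ∀ i, Nonempty (CPNVar V E d i) := fun i => nonempty_of_isProbabilityMeasure (cpnRef V E d i)
  haveI : Nonempty (CPNConfig V E d) := inferInstance
  obtain ⟨ωa, -, hmin⟩ := isCompact_univ.exists_isMinOn Set.univ_nonempty hS.continuousOn
  obtain ⟨ωb, -, hmax⟩ := isCompact_univ.exists_isMaxOn Set.univ_nonempty hS.continuousOn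
  have hωa : ∀ ω, cpnAction src tgt J c ωa ≤ cpnAction src tgt J c ω := fun ω => (isMinOn_iff.1 hmin) ω (Set.mem_univ ω)
  have hωb : ∀ ω, cpnAction src tgt J c ω ≤ cpnAction src tgt J c ωb := fun ω => (isMaxOn_iff.1 hmax) ω (Set.mem_univ ω)
  exact isMarkovKernel_heatBathSweep (μ := cpnRef V E d) (measurable_gibbsDensity hS)
    (m := ENNReal.ofReal (Real.exp (-cpnAction src tgt J c ωb)))
    (M := ENNReal.ofReal (Real.exp (-cpnAction src tgt J c ωa)))
    (by rw [Ne, ENNReal.ofReal_eq_zero, not_le]; exact Real.exp_pos _) ENNReal.ofReal_ne_top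
    (fun ω => (gibbsDensity_bounds hωa hωb ω).1) (fun ω => (gibbsDensity_bounds hωa hωb ω).2) l

/-- **THE COMPOSITE `cpn_2d` SWEEP "HEAT BATHS, THEN ANY EXACT UPDATE" IS MINORISED IN ONE STEP** by
the probability law `(⊗ uniform).bind η`, with an explicit `ε ∈ (0, 1)`, and leaves `cpnGibbsLaw`
invariant. -/
theorem cpn_heatBathSweep_comp_minorised {l : List (V ⊕ E)} (hl : ∀ i, i ∈ l)
    (η : Kernel (CPNConfig V E d) (CPNConfig V E d)) [IsMarkovKernel η]
    (hη : Kernel.Invariant η ((Measure.pi (cpnRef V E d)).withDensity (gibbsDensity (cpnAction src tgt J c)))) :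
    Kernel.Invariant (η ∘ₖ cycle (l.map (siteHeatBath (cpnRef V E d) (gibbsDensity (cpnAction src tgt J c)))))
        (cpnGibbsLaw src tgt J c) ∧
    ∃ ε : ℝ≥0∞, 0 < ε ∧ ε < 1 ∧ ∀ (ω : CPNConfig V E d) {A : Set (CPNConfig V E d)}, MeasurableSet A →
      ε * ((Measure.pi (cpnRef V E d)).bind η) A
        ≤ (η ∘ₖ cycle (l.map (siteHeatBath (cpnRef V E d) (gibbsDensity (cpnAction src tgt J c))))) ω A := by
  have hS := continuous_cpnAction src tgt J c (V := V) (E := E) (d := d)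
  have hp := measurable_gibbsDensity hS
  haveI : ∀ i, Nonempty (CPNVar V E d i) := fun i => nonempty_of_isProbabilityMeasure (cpnRef V E d i)
  haveI : Nonempty (CPNConfig V E d) := inferInstance
  obtain ⟨ωa, -, hmin⟩ := isCompact_univ.exists_isMinOn Set.univ_nonempty hS.continuousOn
  obtain ⟨ωb, -, hmax⟩ := isCompact_univ.exists_isMaxOn Set.univ_nonempty hS.continuousOn
  have hωa : ∀ ω, cpnAction src tgt J c ωa ≤ cpnAction src tgt J c ω := fun ω => (isMinOn_iff.1 hmin) ω (Set.mem_univ ω)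
  have hωb : ∀ ω, cpnAction src tgt J c ω ≤ cpnAction src tgt J c ωb := fun ω => (isMaxOn_iff.1 hmax) ω (Set.mem_univ ω)
  set m : ℝ≥0∞ := ENNReal.ofReal (Real.exp (-cpnAction src tgt J c ωb)) with hm
  set M : ℝ≥0∞ := ENNReal.ofReal (Real.exp (-cpnAction src tgt J c ωa)) with hM
  have hm0 : m ≠ 0 := by rw [hm, Ne, ENNReal.ofReal_eq_zero, not_le]; exact Real.exp_pos _
  have hMtop : M ≠ ∞ := ENNReal.ofReal_ne_top
  have hmp : ∀ ω, m ≤ gibbsDensity (cpnAction src tgt J c) ω := fun ω => (gibbsDensity_bounds hωa hωb ω).1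
  have hpM : ∀ ω, gibbsDensity (cpnAction src tgt J c) ω ≤ M := fun ω => (gibbsDensity_bounds hωa hωb ω).2
  haveI := isMarkovKernel_heatBathSweep (μ := cpnRef V E d) hp hm0 hMtop hmp hpM l
  have hinvK := heatBathSweep_invariant_piGibbsLaw (μ := cpnRef V E d) hp hm0 hMtop hmp hpM l
  refine ⟨(invariant_smul hη _).comp hinvK, ?_⟩
  have hdoeb := fun a => minorised_comp_left
    (heatBathSweep_minorised (μ := cpnRef V E d) hp hm0 hMtop hmp hpM hl) η a
  set δE : ℝ≥0∞ := (m * M⁻¹) ^ l.length with hδE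
  haveI hbind : IsProbabilityMeasure ((Measure.pi (cpnRef V E d)).bind η) :=
    ⟨by rw [Measure.bind_apply MeasurableSet.univ (Kernel.aemeasurable _)]; simp⟩
  have hδ1 : δE ≤ 1 := by
    have h := Measure.le_iff'.1 (hdoeb ωa) Set.univ
    rw [Measure.smul_apply, smul_eq_mul, measure_univ, mul_one] at h
    exact h.trans prob_le_one
  have hδ0 : δE ≠ 0 := pow_ne_zero _ (mul_ne_zero hm0 (ENNReal.inv_ne_zero.2 hMtop))
  have hδtop : δE ≠ ⊤ := ne_top_of_le_ne_top ENNReal.one_ne_top hδ1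
  refine ⟨δE / 2, ENNReal.div_pos hδ0 (by norm_num), ?_, fun ω A _ => ?_⟩
  · exact lt_of_lt_of_le (ENNReal.half_lt_self hδ0 hδtop) hδ1
  · have h := Measure.le_iff'.1 (hdoeb ω) A
    rw [Measure.smul_apply, smul_eq_mul] at h
    exact (mul_le_mul' ENNReal.half_le_self le_rfl).trans h

/-- **THE CLT FOR TIME AVERAGES OF THE COMPOSITE `cpn_2d` HEAT-BATH SWEEP**, from every initial law. -/
theorem cpn_heatBathSweep_comp_timeAverage_clt {l : List (V ⊕ E)} (hl : ∀ i, i ∈ l)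
    (η : Kernel (CPNConfig V E d) (CPNConfig V E d)) [IsMarkovKernel η]
    (hη : Kernel.Invariant η ((Measure.pi (cpnRef V E d)).withDensity (gibbsDensity (cpnAction src tgt J c))))
    {f : CPNConfig V E d → ℝ} (hf : Measurable f) {C : ℝ}
    (hC : ∀ ω, |f ω| ≤ C) (μ₀ : Measure (CPNConfig V E d)) [IsProbabilityMeasure μ₀]
    {Ω' : Type*} [MeasurableSpace Ω'] {P' : Measure Ω'} [IsProbabilityMeasure P'] {Y : Ω' → ℝ}
    (hY : HasLaw Y (gaussianReal 0 (Real.toNNReal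
      ((∫ y, (f y - ∫ z, f z ∂(cpnGibbsLaw src tgt J c)) ^ 2 ∂(cpnGibbsLaw src tgt J c))
        + 2 * ∑' k, ∫ y, (f y - ∫ z, f z ∂(cpnGibbsLaw src tgt J c))
          * (kop (η ∘ₖ cycle (l.map (siteHeatBath (cpnRef V E d) (gibbsDensity (cpnAction src tgt J c))))))^[k + 1]
            (fun y => f y - ∫ z, f z ∂(cpnGibbsLaw src tgt J c)) y ∂(cpnGibbsLaw src tgt J c)))) P')
    [hK : IsMarkovKernel (cycle (l.map (siteHeatBath (cpnRef V E d) (gibbsDensity (cpnAction src tgt J c)))))]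
    [IsProbabilityMeasure (Kernel.trajMeasure (X := fun _ : ℕ => CPNConfig V E d) μ₀
        (fun n : ℕ => (η ∘ₖ cycle (l.map (siteHeatBath (cpnRef V E d) (gibbsDensity (cpnAction src tgt J c))))).comap
          (fun h : (i : ↥(Finset.Iic n)) → CPNConfig V E d => h ⟨n, Finset.mem_Iic.2 le_rfl⟩)
          (measurable_pi_apply _)))] :
    TendstoInDistribution (fun (n : ℕ) (x : ℕ → CPNConfig V E d) =>
        (Real.sqrt n)⁻¹ * ∑ t ∈ Finset.range n, (f (x t) - ∫ z, f z ∂(cpnGibbsLaw src tgt J c)))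
      atTop Y (fun _ => (Kernel.trajMeasure (X := fun _ : ℕ => CPNConfig V E d) μ₀
        (fun n : ℕ => (η ∘ₖ cycle (l.map (siteHeatBath (cpnRef V E d) (gibbsDensity (cpnAction src tgt J c))))).comap
          (fun h : (i : ↥(Finset.Iic n)) → CPNConfig V E d => h ⟨n, Finset.mem_Iic.2 le_rfl⟩)
          (measurable_pi_apply _)))) P' := by
  haveI := isProbabilityMeasure_cpnGibbsLaw src tgt J c (V := V) (E := E) (d := d)
  haveI hbind : IsProbabilityMeasure ((Measure.pi (cpnRef V E d)).bind η) :=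
    ⟨by rw [Measure.bind_apply MeasurableSet.univ (Kernel.aemeasurable _)]; simp⟩
  obtain ⟨hinv, ε, hε0, hε1, hdoeb⟩ := cpn_heatBathSweep_comp_minorised src tgt J c hl η hη
  exact markovChain_clt (κ := η ∘ₖ cycle (l.map (siteHeatBath (cpnRef V E d) (gibbsDensity (cpnAction src tgt J c)))))
    (ν := (Measure.pi (cpnRef V E d)).bind η) hinv (fun ω _ hA => hdoeb ω hA) hε0 hε1 hf hC μ₀ hY

/-- **BATCH MEANS ESTIMATE `σ²_f` CONSISTENTLY ALONG THE COMPOSITE `cpn_2d` HEAT-BATH RUN**, any start. -/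
theorem cpn_heatBathSweep_comp_batchMeans_tendstoInMeasure {l : List (V ⊕ E)} (hl : ∀ i, i ∈ l)
    (η : Kernel (CPNConfig V E d) (CPNConfig V E d)) [IsMarkovKernel η]
    (hη : Kernel.Invariant η ((Measure.pi (cpnRef V E d)).withDensity (gibbsDensity (cpnAction src tgt J c))))
    {f : CPNConfig V E d → ℝ} (hf : Measurable f) {C : ℝ}
    (hC : ∀ ω, |f ω| ≤ C) (μ₀ : Measure (CPNConfig V E d)) [IsProbabilityMeasure μ₀]
    {a b : ℕ → ℕ} (ha : Tendsto a atTop atTop) (hb : Tendsto b atTop atTop)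
    [hK : IsMarkovKernel (cycle (l.map (siteHeatBath (cpnRef V E d) (gibbsDensity (cpnAction src tgt J c)))))] :
    TendstoInMeasure (Kernel.trajMeasure (X := fun _ : ℕ => CPNConfig V E d) μ₀
        (fun n : ℕ => (η ∘ₖ cycle (l.map (siteHeatBath (cpnRef V E d) (gibbsDensity (cpnAction src tgt J c))))).comap
          (fun h : (i : ↥(Finset.Iic n)) → CPNConfig V E d => h ⟨n, Finset.mem_Iic.2 le_rfl⟩)
          (measurable_pi_apply _)))
      (fun (n : ℕ) (x : ℕ → CPNConfig V E d) => ((b n * a n : ℕ) : ℝ)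
        * replicaSEsq (fun j (x : ℕ → CPNConfig V E d) =>
            (∑ i ∈ Finset.range (b n), f (x (b n * j + i))) / (b n)) (a n) x)
      atTop (fun _ => (∫ y, (f y - ∫ z, f z ∂(cpnGibbsLaw src tgt J c)) ^ 2 ∂(cpnGibbsLaw src tgt J c))
        + 2 * ∑' k, ∫ y, (f y - ∫ z, f z ∂(cpnGibbsLaw src tgt J c))
          * (kop (η ∘ₖ cycle (l.map (siteHeatBath (cpnRef V E d) (gibbsDensity (cpnAction src tgt J c))))))^[k + 1]
            (fun y => f y - ∫ z, f z ∂(cpnGibbsLaw src tgt J c)) y ∂(cpnGibbsLaw src tgt J c)) := by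
  haveI := isProbabilityMeasure_cpnGibbsLaw src tgt J c (V := V) (E := E) (d := d)
  haveI hbind : IsProbabilityMeasure ((Measure.pi (cpnRef V E d)).bind η) :=
    ⟨by rw [Measure.bind_apply MeasurableSet.univ (Kernel.aemeasurable _)]; simp⟩
  obtain ⟨hinv, ε, hε0, hε1, hdoeb⟩ := cpn_heatBathSweep_comp_minorised src tgt J c hl η hη
  exact chain_batchMeans_sigmaHat_tendstoInMeasure
    (κ := η ∘ₖ cycle (l.map (siteHeatBath (cpnRef V E d) (gibbsDensity (cpnAction src tgt J c)))))
    (ν := (Measure.pi (cpnRef V E d)).bind η) hinv (fun ω _ hA => hdoeb ω hA) hε0 hε1 hf hC μ₀ ha hb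

/-- **THE COIN-FREE BATCH-MEANS INTERVAL OF THE COMPOSITE `cpn_2d` HEAT-BATH RUN IS ASYMPTOTICALLY
EXACT** (`σ²_f > 0`, `a_n, b_n → ∞`, any initial law, `z > 0`). -/
theorem cpn_heatBathSweep_comp_batchMeans_coverage {l : List (V ⊕ E)} (hl : ∀ i, i ∈ l)
    (η : Kernel (CPNConfig V E d) (CPNConfig V E d)) [IsMarkovKernel η]
    (hη : Kernel.Invariant η ((Measure.pi (cpnRef V E d)).withDensity (gibbsDensity (cpnAction src tgt J c))))
    {f : CPNConfig V E d → ℝ} (hf : Measurable f) {C : ℝ}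
    (hC : ∀ ω, |f ω| ≤ C)
    (hσ : 0 < (∫ y, (f y - ∫ z, f z ∂(cpnGibbsLaw src tgt J c)) ^ 2 ∂(cpnGibbsLaw src tgt J c))
        + 2 * ∑' k, ∫ y, (f y - ∫ z, f z ∂(cpnGibbsLaw src tgt J c))
          * (kop (η ∘ₖ cycle (l.map (siteHeatBath (cpnRef V E d) (gibbsDensity (cpnAction src tgt J c))))))^[k + 1]
            (fun y => f y - ∫ z, f z ∂(cpnGibbsLaw src tgt J c)) y ∂(cpnGibbsLaw src tgt J c))
    (μ₀ : Measure (CPNConfig V E d)) [IsProbabilityMeasure μ₀]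
    {a b : ℕ → ℕ} (ha : Tendsto a atTop atTop) (hb : Tendsto b atTop atTop) {z : ℝ} (hz : 0 < z)
    [hK : IsMarkovKernel (cycle (l.map (siteHeatBath (cpnRef V E d) (gibbsDensity (cpnAction src tgt J c)))))] :
    Tendsto (fun n : ℕ => (Kernel.trajMeasure (X := fun _ : ℕ => CPNConfig V E d) μ₀
        (fun n : ℕ => (η ∘ₖ cycle (l.map (siteHeatBath (cpnRef V E d) (gibbsDensity (cpnAction src tgt J c))))).comap
          (fun h : (i : ↥(Finset.Iic n)) → CPNConfig V E d => h ⟨n, Finset.mem_Iic.2 le_rfl⟩)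
          (measurable_pi_apply _))).real
      {x | |((Real.sqrt ((b n * a n : ℕ) : ℝ))⁻¹
          * ∑ t ∈ Finset.range (b n * a n), (f (x t) - ∫ z, f z ∂(cpnGibbsLaw src tgt J c)))
        / Real.sqrt (((b n * a n : ℕ) : ℝ)
          * replicaSEsq (fun j (x : ℕ → CPNConfig V E d) =>
              (∑ i ∈ Finset.range (b n), f (x (b n * j + i))) / (b n)) (a n) x)| ≤ z})
      atTop (𝓝 ((gaussianReal 0 1).real (Set.Icc (-z) z))) := by
  haveI := isProbabilityMeasure_cpnGibbsLaw src tgt J c (V := V) (E := E) (d := d)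
  haveI hbind : IsProbabilityMeasure ((Measure.pi (cpnRef V E d)).bind η) :=
    ⟨by rw [Measure.bind_apply MeasurableSet.univ (Kernel.aemeasurable _)]; simp⟩
  obtain ⟨hinv, ε, hε0, hε1, hdoeb⟩ := cpn_heatBathSweep_comp_minorised src tgt J c hl η hη
  exact markovChain_batchMeans_studentized_coverage
    (κ := η ∘ₖ cycle (l.map (siteHeatBath (cpnRef V E d) (gibbsDensity (cpnAction src tgt J c)))))
    (ν := (Measure.pi (cpnRef V E d)).bind η) hinv (fun ω _ hA => hdoeb ω hA) hε0 hε1 hf hC hσ μ₀ ha hb hz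

end CPNHeatBath

end Summit.Ventures.LatticeQCDFlow.Scoring

end
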